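import Literature.Analysis.Complex.HarmonicSchwarzReflection
import Literature.Analysis.Complex.HalfPlaneTwoArcHarmonic
import HarnessLib

/-!
# The three-arc mixed Dirichlet–Neumann problem on the half-plane: identification of bounded solutions

Topic `Literature/Analysis/Complex` (harmonic functions; capstone of `HarmonicSchwarzReflection.lean`
and `HalfPlaneTwoArcHarmonic.lean`). G. F. Lawler, O. Schramm, W. Werner, Ann. Probab. 32 (2004),
proof of Prop. 4.2 (arXiv math/0112234, p. 22): "Note that `h` is harmonic in `ℍ`, is equal to
`0` on `(0,1)`, is equal to `1` on `(1,∞)`, and `∂_y h = 0` on `(-∞,0)`. (Of course, we found the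
map `h` satisfying these boundary conditions by reflecting the domain along the negative real
axis, mapping this larger domain to `ℍ` with `z ↦ √z`, and then using a conformal map from `ℍ` to
`𝕌` to calculate the hitting probabilities.)" We prove the corresponding **uniqueness**
statement, in the form in which a subsequential scaling limit of the discrete mixed-harmonic
functions is identified: a bounded harmonic `H` on `ℍ` with boundary values `0` on `(0,1)` and
`1` on `(1,∞)`, whose Neumann condition on `(-∞,0)` is expressed through a (local) harmonic
conjugate tending to `0` there, satisfies `H(w²) = 1 - ω(w)` on the first quadrant, where
`ω = hmSeg` is the harmonic measure of `[-1,1]` in `ℍ` (`eq_one_sub_hmSeg_sq`). Proof: the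
function `u(w) = H(w²)` on the first quadrant reflects evenly across the imaginary axis to a
bounded harmonic function on `ℍ` (the conjugate vanishing on the Neumann side makes `H + iK`
reflectable, `exists_differentiableOn_extension_of_tendsto_im`, in the rotated variable
`ζ = iw`), whose boundary values are `0` on `(-1,1)` and `1` on `|x| > 1` away from `{0, ±1}`;
conclude by `eq_one_sub_hmSeg`. Everything is proved.

## References

* G. F. Lawler, O. Schramm, W. Werner, Ann. Probab. 32 (2004), proof of Prop. 4.2 (arXiv p. 22).
  [LawlerSchrammWerner2004]
* L. V. Ahlfors, *Complex Analysis* (1979), Ch. 4 §6.5. [Ahlfors1979]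
-/

noncomputable section

open Set Filter Metric Topology Complex InnerProductSpace
open UpperHalfPlane (upperHalfPlaneSet)
open scoped ComplexConjugate

namespace Literature.Analysis.Complex

namespace ThreeArc

/-- The first quadrant. [folklore] -/
def Q₁ : Set ℂ := {w | 0 < w.re ∧ 0 < w.im}

/-- Squares of first-quadrant points lie in the upper half-plane. [folklore] -/
theorem sq_mem_upper {w : ℂ} (hre : 0 < w.re) (him : 0 < w.im) : w ^ 2 ∈ upperHalfPlaneSet := by
  show 0 < (w ^ 2).im
  rw [sq, mul_im]; positivity

/-- Squares of conjugates of second-quadrant points lie in the upper half-plane. [folklore] -/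
theorem conj_sq_mem_upper {w : ℂ} (hre : w.re < 0) (him : 0 < w.im) :
    (conj w) ^ 2 ∈ upperHalfPlaneSet := by
  show 0 < ((conj w) ^ 2).im
  rw [sq, mul_im, conj_re, conj_im]; nlinarith

/-- Points of the open positive imaginary axis are limits of first-quadrant points. [folklore] -/
theorem neBot_nhdsWithin_Q₁ {w : ℂ} (hre : 0 ≤ w.re) (him : 0 < w.im) : (𝓝[Q₁] w).NeBot := by
  rw [← mem_closure_iff_nhdsWithin_neBot, Metric.mem_closure_iff]
  intro ε hε
  refine ⟨w + (ε / 2 : ℝ), ⟨?_, ?_⟩, ?_⟩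
  · show 0 < (w + (ε / 2 : ℝ)).re
    simp; linarith
  · show 0 < (w + (ε / 2 : ℝ)).im
    simpa using him
  · rw [dist_eq_norm, sub_add_cancel_left, norm_neg, Complex.norm_real, Real.norm_eq_abs,
      abs_of_pos (by positivity)]
    linarith

/-- `H ∘ (·)²` is harmonic on the first quadrant when `H` is harmonic on `ℍ`. [folklore] -/
theorem harmonicAt_comp_sq {H : ℂ → ℝ} (hH : HarmonicOnNhd H upperHalfPlaneSet) {w : ℂ}
    (hre : 0 < w.re) (him : 0 < w.im) : HarmonicAt (fun w ↦ H (w ^ 2)) w := by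
  have hξ : w ^ 2 ∈ upperHalfPlaneSet := sq_mem_upper hre him
  obtain ⟨ρ, hρ, hball⟩ := Metric.isOpen_iff.1 UpperHalfPlane.isOpen_upperHalfPlaneSet _ hξ
  obtain ⟨Φ, hΦa, hΦre⟩ := (hH.mono hball).exists_analyticOnNhd_ball_re_eq
  have hpre : (fun w : ℂ ↦ w ^ 2) ⁻¹' ball (w ^ 2) ρ ∈ 𝓝 w :=
    (continuous_pow 2).continuousAt.preimage_mem_nhds (ball_mem_nhds _ hρ)
  have hev : (fun w ↦ H (w ^ 2)) =ᶠ[𝓝 w] fun w ↦ (Φ (w ^ 2)).re := by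
    filter_upwards [hpre] with v hv
    exact (hΦre hv).symm
  refine (harmonicAt_congr_nhds hev).2 ?_
  have hsq : AnalyticAt ℂ (fun v : ℂ ↦ v ^ 2) w := analyticAt_id.pow 2
  exact ((hΦa _ (mem_ball_self hρ)).comp_of_eq hsq rfl).harmonicAt_re

/-- `H((conj ·)²)` is harmonic on the second quadrant when `H` is harmonic on `ℍ`. [folklore] -/
theorem harmonicAt_comp_conj_sq {H : ℂ → ℝ} (hH : HarmonicOnNhd H upperHalfPlaneSet) {w : ℂ}
    (hre : w.re < 0) (him : 0 < w.im) : HarmonicAt (fun w ↦ H ((conj w) ^ 2)) w := by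
  have hξ : (conj w) ^ 2 ∈ upperHalfPlaneSet := conj_sq_mem_upper hre him
  obtain ⟨ρ, hρ, hball⟩ := Metric.isOpen_iff.1 UpperHalfPlane.isOpen_upperHalfPlaneSet _ hξ
  obtain ⟨Φ, hΦa, hΦre⟩ := (hH.mono hball).exists_analyticOnNhd_ball_re_eq
  -- `(conj v)² = conj (v²)`, and `H ∘ conj = re (conj ∘ Φ ∘ conj)`
  have hcont : Continuous fun v : ℂ ↦ (conj v) ^ 2 := (Complex.continuous_conj).pow 2
  have hpre : (fun v : ℂ ↦ (conj v) ^ 2) ⁻¹' ball ((conj w) ^ 2) ρ ∈ 𝓝 w :=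
    hcont.continuousAt.preimage_mem_nhds (ball_mem_nhds _ hρ)
  set Ψ : ℂ → ℂ := conj ∘ Φ ∘ conj with hΨ
  have hev : (fun v ↦ H ((conj v) ^ 2)) =ᶠ[𝓝 w] fun v ↦ (Ψ (v ^ 2)).re := by
    filter_upwards [hpre] with v hv
    rw [← hΦre hv, hΨ]
    simp [map_pow]
  refine (harmonicAt_congr_nhds hev).2 ?_
  have hΨd : DifferentiableAt ℂ Ψ (w ^ 2) := by
    rw [hΨ, differentiableAt_conj_conj_iff]
    have : conj (w ^ 2) = (conj w) ^ 2 := map_pow _ _ _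
    rw [this]
    exact (hΦa _ (mem_ball_self hρ)).differentiableAt
  -- `Ψ` is differentiable on a neighbourhood, hence analytic at `w²`
  have hΨd' : ∀ᶠ ξ in 𝓝 (w ^ 2), DifferentiableAt ℂ Ψ ξ := by
    have hpre' : conj ⁻¹' ball ((conj w) ^ 2) ρ ∈ 𝓝 (w ^ 2) := by
      refine Complex.continuous_conj.continuousAt.preimage_mem_nhds ?_
      have : conj (w ^ 2) = (conj w) ^ 2 := map_pow _ _ _
      rw [this]; exact ball_mem_nhds _ hρ
    filter_upwards [hpre'] with ξ hξ'
    rw [hΨ, differentiableAt_conj_conj_iff]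
    exact (hΦa _ hξ').differentiableAt
  have hΨa : AnalyticAt ℂ Ψ (w ^ 2) := by
    obtain ⟨O, hO, hOo, hOw⟩ := _root_.eventually_nhds_iff.1 hΨd'
    exact (DifferentiableOn.analyticAt (fun ξ hξ ↦ (hO ξ hξ).differentiableWithinAt) (hOo.mem_nhds hOw))
  have hsq : AnalyticAt ℂ (fun v : ℂ ↦ v ^ 2) w := analyticAt_id.pow 2
  exact (hΨa.comp_of_eq hsq rfl).harmonicAt_re

/-- **The even reflection across the imaginary axis of `H ∘ (·)²`, at an axis point.** Under the
local Neumann hypothesis at `x = -t² < 0` (a holomorphic `G` on `B(x, r) ∩ ℍ` with `re G = H`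
and `im G → 0` at the real points of the ball), about the axis point `w₀ = it` there is a
holomorphic `F` on a disc with `re F(w) = H(w²)` for `re w > 0` and `re F(w) = H(w̄²)` for
`re w < 0` (the reflection principle `exists_differentiableOn_extension_of_tendsto_im` in the
variable `ζ = iw`, in which `z = w² = -ζ²` and the imaginary `w`-axis is the real `ζ`-axis).
[cite: Ahlfors1979, Ch. 4 §6.5 Thm. 26] -/
theorem exists_local_even_reflection {H : ℂ → ℝ} {t : ℝ} (ht : 0 < t) {r : ℝ} (hr : 0 < r)
    {G : ℂ → ℂ} (hG : DifferentiableOn ℂ G (ball ((-t ^ 2 : ℝ) : ℂ) r ∩ upperHalfPlaneSet))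
    (hGre : ∀ z ∈ ball ((-t ^ 2 : ℝ) : ℂ) r ∩ upperHalfPlaneSet, (G z).re = H z)
    (hGim : ∀ y : ℝ, (y : ℂ) ∈ ball ((-t ^ 2 : ℝ) : ℂ) r →
      Tendsto (fun z ↦ (G z).im) (𝓝[ball ((-t ^ 2 : ℝ) : ℂ) r ∩ upperHalfPlaneSet] (y : ℂ)) (𝓝 0)) :
    ∃ ε > 0, ∃ F : ℂ → ℂ, DifferentiableOn ℂ F (ball (t * I) ε) ∧
      (∀ w ∈ ball (t * I) ε, 0 < w.re → (F w).re = H (w ^ 2)) ∧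
      (∀ w ∈ ball (t * I) ε, w.re < 0 → (F w).re = H ((conj w) ^ 2)) := by
  set x : ℝ := -t ^ 2 with hx
  set Bx : Set ℂ := ball (x : ℂ) r with hBx
  -- the variable `ζ`, `z = ψ ζ = -ζ²`
  set ψ : ℂ → ℂ := fun ζ ↦ -ζ ^ 2 with hψ
  have hψc : Continuous ψ := (continuous_pow 2).neg
  have hψconj : ∀ ζ, ψ (conj ζ) = conj (ψ ζ) := fun ζ ↦ by simp [hψ, map_pow]
  have hBconj : ∀ z ∈ Bx, conj z ∈ Bx := fun z hz ↦ by
    rw [hBx, mem_ball] at hz ⊢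
    rwa [← Complex.conj_ofReal, Complex.dist_conj_conj]
  set Uζ : Set ℂ := {ζ | ζ.re < 0} ∩ ψ ⁻¹' Bx with hUζ
  have hUo : IsOpen Uζ := (isOpen_lt Complex.continuous_re continuous_const).inter (isOpen_ball.preimage hψc)
  have hUsymm : ∀ ζ ∈ Uζ, conj ζ ∈ Uζ := fun ζ hζ ↦
    ⟨by simpa using hζ.1, by show ψ (conj ζ) ∈ Bx; rw [hψconj]; exact hBconj _ hζ.2⟩
  have hψup : ∀ ζ ∈ Uζ ∩ {ζ | 0 < ζ.im}, ψ ζ ∈ Bx ∩ upperHalfPlaneSet := fun ζ hζ ↦ by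
    refine ⟨hζ.1.2, ?_⟩
    show 0 < (ψ ζ).im
    have h1 : ζ.re < 0 := hζ.1.1
    have h2 : 0 < ζ.im := hζ.2
    simp only [hψ, neg_im, sq, mul_im]
    nlinarith
  -- the reflection principle for `f = G ∘ ψ`
  have hf : DifferentiableOn ℂ (G ∘ ψ) (Uζ ∩ {ζ | 0 < ζ.im}) :=
    hG.comp ((differentiable_pow 2).neg.differentiableOn) hψup
  have hlim : ∀ y ∈ Uζ, y.im = 0 →
      Tendsto (fun ζ ↦ ((G ∘ ψ) ζ).im) (𝓝[Uζ ∩ {ζ | 0 < ζ.im}] y) (𝓝 0) := by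
    intro y hy hyim
    have hψy : ψ y = ((-(y.re) ^ 2 : ℝ) : ℂ) := by
      have hyre : y = (y.re : ℂ) := by apply Complex.ext <;> simp [hyim]
      show -y ^ 2 = _
      conv_lhs => rw [hyre]
      push_cast; ring
    have hmem : ((-(y.re) ^ 2 : ℝ) : ℂ) ∈ Bx := by rw [← hψy]; exact hy.2
    have h1 := hGim _ hmem
    rw [← hψy] at h1
    refine h1.comp ?_
    refine tendsto_nhdsWithin_of_tendsto_nhds_of_eventually_within _ ?_ ?_
    · exact (hψc.tendsto y).mono_left nhdsWithin_le_nhds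
    · filter_upwards [self_mem_nhdsWithin] with ζ hζ using hψup ζ hζ
  obtain ⟨F₁, hF₁d, hF₁f, hF₁symm, -⟩ :=
    exists_differentiableOn_extension_of_tendsto_im hUo hUsymm hf hlim
  -- pull back to the variable `w` via `ζ = I w`
  have hw₀ : I * (t * I) ∈ Uζ := by
    have : I * (t * I) = ((-t : ℝ) : ℂ) := by push_cast; ring_nf; rw [I_sq]; ring
    rw [this]
    refine ⟨by simp; exact ht, ?_⟩
    show ψ ((-t : ℝ) : ℂ) ∈ Bx
    have : ψ ((-t : ℝ) : ℂ) = (x : ℂ) := by rw [hψ, hx]; push_cast; ring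
    rw [this]; exact mem_ball_self hr
  obtain ⟨ε₀, hε₀, hball₀⟩ := Metric.isOpen_iff.1 hUo _ hw₀
  set ε : ℝ := min ε₀ t with hε
  have hεpos : 0 < ε := lt_min hε₀ ht
  have hIw : ∀ w ∈ ball (t * I) ε, I * w ∈ Uζ := fun w hw ↦ by
    refine hball₀ ?_
    rw [mem_ball, dist_eq_norm] at hw ⊢
    calc ‖I * w - I * (t * I)‖ = ‖I * (w - t * I)‖ := by ring_nf
      _ = ‖w - t * I‖ := by rw [norm_mul, norm_I, one_mul]
      _ < ε := hw
      _ ≤ ε₀ := min_le_left _ _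
  refine ⟨ε, hεpos, fun w ↦ F₁ (I * w), ?_, ?_, ?_⟩
  · intro w hw
    have h1 : DifferentiableAt ℂ F₁ (I * w) := hF₁d.differentiableAt (hUo.mem_nhds (hIw w hw))
    exact (h1.comp w ((differentiableAt_id.const_mul I))).differentiableWithinAt
  · intro w hw hre
    have hup : I * w ∈ Uζ ∩ {ζ | 0 < ζ.im} := ⟨hIw w hw, by show 0 < (I * w).im; simpa using hre⟩
    show (F₁ (I * w)).re = H (w ^ 2)
    rw [hF₁f hup, Function.comp_apply]
    have hψI : ψ (I * w) = w ^ 2 := by rw [hψ]; ring_nf; rw [I_sq]; ring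
    rw [hψI, hGre]
    rw [← hψI]; exact hψup _ hup
  · intro w hw hre
    -- `F₁ (I w) = conj (F₁ (conj (I w)))` and `conj (I w) = I (-conj w)` with `-conj w` in `Q₁`
    have hsymm : F₁ (I * w) = conj (F₁ (conj (I * w))) := by
      have := hF₁symm (I * w) (hIw w hw)
      rw [this, Complex.conj_conj]
    have hconj : conj (I * w) = I * (-conj w) := by rw [map_mul, Complex.conj_I]; ring
    have hw' : -conj w ∈ ball (t * I) ε := by
      rw [mem_ball, dist_eq_norm] at hw ⊢
      have : -conj w - t * I = -(conj (w - t * I)) := by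
        rw [map_sub, map_mul, Complex.conj_ofReal, Complex.conj_I]; ring
      rw [this, norm_neg, Complex.norm_conj]; exact hw
    have hup : I * (-conj w) ∈ Uζ ∩ {ζ | 0 < ζ.im} :=
      ⟨hIw _ hw', by show 0 < (I * (-conj w)).im; simp; linarith⟩
    show (F₁ (I * w)).re = H ((conj w) ^ 2)
    rw [hsymm, Complex.conj_re, hconj, hF₁f hup, Function.comp_apply]
    have hψI : ψ (I * (-conj w)) = (conj w) ^ 2 := by rw [hψ]; ring_nf; rw [I_sq]; ring
    rw [hψI, hGre]
    rw [← hψI]; exact hψup _ hup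

/-- Squaring maps `𝓝[ℍ] x` (`x > 0` real) into `𝓝[ℍ] x²`, eventually through the first
quadrant. [folklore] -/
theorem tendsto_sq_nhdsWithin_of_pos {x : ℝ} (hx : 0 < x) :
    Tendsto (fun v : ℂ ↦ v ^ 2) (𝓝[upperHalfPlaneSet] (x : ℂ))
      (𝓝[upperHalfPlaneSet] (((x ^ 2 : ℝ)) : ℂ)) := by
  refine tendsto_nhdsWithin_of_tendsto_nhds_of_eventually_within _ ?_ ?_
  · have : ((x ^ 2 : ℝ) : ℂ) = (x : ℂ) ^ 2 := by push_cast; ring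
    rw [this]
    exact ((continuous_pow 2).tendsto (x : ℂ)).mono_left nhdsWithin_le_nhds
  · have hre : ∀ᶠ v in 𝓝[upperHalfPlaneSet] (x : ℂ), 0 < v.re :=
      mem_nhdsWithin_of_mem_nhds ((isOpen_lt continuous_const Complex.continuous_re).mem_nhds
        (by simpa using hx))
    filter_upwards [hre, self_mem_nhdsWithin] with v hv hvU
    exact sq_mem_upper hv hvU

/-- Conjugate-squaring maps `𝓝[ℍ] x` (`x < 0` real) into `𝓝[ℍ] x²`, eventually through the
second quadrant. [folklore] -/
theorem tendsto_conj_sq_nhdsWithin_of_neg {x : ℝ} (hx : x < 0) :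
    Tendsto (fun v : ℂ ↦ (conj v) ^ 2) (𝓝[upperHalfPlaneSet] (x : ℂ))
      (𝓝[upperHalfPlaneSet] (((x ^ 2 : ℝ)) : ℂ)) := by
  refine tendsto_nhdsWithin_of_tendsto_nhds_of_eventually_within _ ?_ ?_
  · have : ((x ^ 2 : ℝ) : ℂ) = (conj (x : ℂ)) ^ 2 := by rw [Complex.conj_ofReal]; push_cast; ring
    rw [this]
    exact ((Complex.continuous_conj.pow 2).tendsto (x : ℂ)).mono_left nhdsWithin_le_nhds
  · have hre : ∀ᶠ v in 𝓝[upperHalfPlaneSet] (x : ℂ), v.re < 0 :=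
      mem_nhdsWithin_of_mem_nhds ((isOpen_lt Complex.continuous_re continuous_const).mem_nhds
        (by simpa using hx))
    filter_upwards [hre, self_mem_nhdsWithin] with v hv hvU
    exact conj_sq_mem_upper hv hvU

/-- **Identification of bounded solutions of the three-arc mixed problem on `ℍ`** (the function
`h` of Lawler–Schramm–Werner (2004), Prop. 4.2). Let `H` be harmonic and bounded on `ℍ`, with
boundary values `0` on `(0, 1)` and `1` on `(1, ∞)`, and satisfying the Neumann condition on
`(-∞, 0)` in the conjugate form: about every point `-t²` (`t > 0`) there is a holomorphic `G` on
`B(-t², r) ∩ ℍ` with `re G = H` and `im G → 0` at the real points of the disc. Then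
`H(w²) = 1 - ω(w)` for every `w` in the open first quadrant, `ω = hmSeg` the harmonic measure of
`[-1, 1]` in `ℍ`. Proof: `u(w) = H(w²)` (first quadrant), `H(w̄²)` (second quadrant), extended to
the imaginary axis by its limits, is harmonic on `ℍ` (`exists_local_even_reflection` at the axis),
bounded by the bound of `H`, with boundary values `0` on `(-1,1) ∖ {0}` and `1` on `|x| > 1`; apply
`eq_one_sub_hmSeg` with exceptional set `{-1, 0, 1}`.
[cite: LawlerSchrammWerner2004, Prop. 4.2 (proof, arXiv p. 22)] -/
theorem eq_one_sub_hmSeg_sq {H : ℂ → ℝ} (hH : HarmonicOnNhd H upperHalfPlaneSet)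
    {B : ℝ} (hB : ∀ z ∈ upperHalfPlaneSet, |H z| ≤ B)
    (h0 : ∀ x : ℝ, 0 < x → x < 1 → Tendsto H (𝓝[upperHalfPlaneSet] (x : ℂ)) (𝓝 0))
    (h1 : ∀ x : ℝ, 1 < x → Tendsto H (𝓝[upperHalfPlaneSet] (x : ℂ)) (𝓝 1))
    (hN : ∀ t : ℝ, 0 < t → ∃ r > 0, ∃ G : ℂ → ℂ,
      DifferentiableOn ℂ G (ball ((-t ^ 2 : ℝ) : ℂ) r ∩ upperHalfPlaneSet) ∧
      (∀ z ∈ ball ((-t ^ 2 : ℝ) : ℂ) r ∩ upperHalfPlaneSet, (G z).re = H z) ∧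
      ∀ y : ℝ, (y : ℂ) ∈ ball ((-t ^ 2 : ℝ) : ℂ) r →
        Tendsto (fun z ↦ (G z).im) (𝓝[ball ((-t ^ 2 : ℝ) : ℂ) r ∩ upperHalfPlaneSet] (y : ℂ)) (𝓝 0)) :
    ∀ w : ℂ, 0 < w.re → 0 < w.im → H (w ^ 2) = 1 - hmSeg w := by
  classical
  -- the even reflection `u`
  set u : ℂ → ℝ := fun w ↦ if 0 < w.re then H (w ^ 2) else if w.re < 0 then H ((conj w) ^ 2)
      else limUnder (𝓝[Q₁] w) (fun v ↦ H (v ^ 2)) with hu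
  have hu_pos : ∀ w : ℂ, 0 < w.re → u w = H (w ^ 2) := fun w hw ↦ by rw [hu]; exact if_pos hw
  have hu_neg : ∀ w : ℂ, w.re < 0 → u w = H ((conj w) ^ 2) := fun w hw ↦ by
    show (if 0 < w.re then H (w ^ 2) else if w.re < 0 then H ((conj w) ^ 2)
      else limUnder (𝓝[Q₁] w) (fun v ↦ H (v ^ 2))) = _
    rw [if_neg (not_lt.2 hw.le), if_pos hw]
  have hu_ax : ∀ w : ℂ, w.re = 0 → u w = limUnder (𝓝[Q₁] w) (fun v ↦ H (v ^ 2)) := fun w hw ↦ by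
    show (if 0 < w.re then H (w ^ 2) else if w.re < 0 then H ((conj w) ^ 2)
      else limUnder (𝓝[Q₁] w) (fun v ↦ H (v ^ 2))) = _
    rw [if_neg (by rw [hw]; exact lt_irrefl 0), if_neg (by rw [hw]; exact lt_irrefl 0)]
  -- local holomorphic representation at the points of the imaginary axis
  have hax : ∀ w₀ : ℂ, w₀.re = 0 → 0 < w₀.im → ∃ ε > 0, ∃ F : ℂ → ℂ,
      DifferentiableOn ℂ F (ball w₀ ε) ∧ ∀ w ∈ ball w₀ ε, 0 < w.im → u w = (F w).re := by
    intro w₀ hre him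
    have hw₀ : (w₀.im : ℂ) * I = w₀ := by
      apply Complex.ext <;> simp [hre]
    obtain ⟨r, hr, G, hG, hGre, hGim⟩ := hN w₀.im him
    obtain ⟨ε, hε, F, hFd, hFpos, hFneg⟩ := exists_local_even_reflection (H := H) him hr hG hGre hGim
    rw [hw₀] at hFd hFpos hFneg
    refine ⟨ε, hε, F, hFd, fun w hw hwim ↦ ?_⟩
    rcases lt_trichotomy w.re 0 with hn | hz | hp
    · rw [hu_neg w hn, hFneg w hw hn]
    · rw [hu_ax w hz]
      haveI := neBot_nhdsWithin_Q₁ hz.ge hwim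
      refine Filter.Tendsto.limUnder_eq ?_
      have hFc : ContinuousAt F w := (hFd.differentiableAt (isOpen_ball.mem_nhds hw)).continuousAt
      have hlim : Tendsto (fun v ↦ (F v).re) (𝓝[Q₁] w) (𝓝 ((F w).re)) :=
        ((Complex.continuous_re.continuousAt.comp hFc).tendsto).mono_left nhdsWithin_le_nhds
      refine hlim.congr' ?_
      have hmem : ball w₀ ε ∈ 𝓝[Q₁] w := mem_nhdsWithin_of_mem_nhds (isOpen_ball.mem_nhds hw)
      filter_upwards [hmem, self_mem_nhdsWithin] with v hv hvQ
      exact hFpos v hv hvQ.1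
    · rw [hu_pos w hp, hFpos w hw hp]
  -- `u` is harmonic on `ℍ`
  have hu_harm : HarmonicOnNhd u upperHalfPlaneSet := by
    intro w hw
    have hwim : 0 < w.im := hw
    rcases lt_trichotomy w.re 0 with hn | hz | hp
    · have hev : u =ᶠ[𝓝 w] fun v ↦ H ((conj v) ^ 2) := by
        filter_upwards [(isOpen_lt Complex.continuous_re continuous_const).mem_nhds hn] with v hv
        exact hu_neg v hv
      exact (harmonicAt_congr_nhds hev).2 (harmonicAt_comp_conj_sq hH hn hwim)
    · obtain ⟨ε, hε, F, hFd, hFu⟩ := hax w hz hwim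
      have hev : u =ᶠ[𝓝 w] fun v ↦ (F v).re := by
        filter_upwards [ball_mem_nhds w hε,
          (isOpen_lt continuous_const Complex.continuous_im).mem_nhds hwim] with v hv hvim
        exact hFu v hv hvim
      exact (harmonicAt_congr_nhds hev).2 ((hFd.analyticAt (ball_mem_nhds w hε)).harmonicAt_re)
    · have hev : u =ᶠ[𝓝 w] fun v ↦ H (v ^ 2) := by
        filter_upwards [(isOpen_lt continuous_const Complex.continuous_re).mem_nhds hp] with v hv
        exact hu_pos v hv
      exact (harmonicAt_congr_nhds hev).2 (harmonicAt_comp_sq hH hp hwim)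
  -- `u` is bounded by `B`
  have hu_bd : ∀ w ∈ upperHalfPlaneSet, |u w| ≤ B := by
    intro w hw
    have hwim : 0 < w.im := hw
    rcases lt_trichotomy w.re 0 with hn | hz | hp
    · rw [hu_neg w hn]; exact hB _ (conj_sq_mem_upper hn hwim)
    · obtain ⟨ε, hε, F, hFd, hFu⟩ := hax w hz hwim
      haveI := neBot_nhdsWithin_Q₁ hz.ge hwim
      have hFc : ContinuousAt F w := (hFd.differentiableAt (ball_mem_nhds w hε)).continuousAt
      have hlim : Tendsto (fun v ↦ H (v ^ 2)) (𝓝[Q₁] w) (𝓝 (u w)) := by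
        rw [hFu w (mem_ball_self hε) hwim]
        have h1 : Tendsto (fun v ↦ (F v).re) (𝓝[Q₁] w) (𝓝 ((F w).re)) :=
          ((Complex.continuous_re.continuousAt.comp hFc).tendsto).mono_left nhdsWithin_le_nhds
        refine h1.congr' ?_
        have hmem : ball w ε ∈ 𝓝[Q₁] w := mem_nhdsWithin_of_mem_nhds (ball_mem_nhds w hε)
        filter_upwards [hmem, self_mem_nhdsWithin] with v hv hvQ
        rw [← hu_pos v hvQ.1, hFu v hv hvQ.2]
      have hmemI : ∀ᶠ v in 𝓝[Q₁] w, H (v ^ 2) ∈ Icc (-B) B := by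
        filter_upwards [self_mem_nhdsWithin] with v hv
        exact abs_le.1 (hB _ (sq_mem_upper hv.1 hv.2))
      exact abs_le.2 (isClosed_Icc.mem_of_tendsto hlim hmemI)
    · rw [hu_pos w hp]; exact hB _ (sq_mem_upper hp hwim)
  -- boundary values
  have hbv_pos : ∀ x : ℝ, 0 < x → ∀ L : ℝ,
      Tendsto H (𝓝[upperHalfPlaneSet] (((x ^ 2 : ℝ)) : ℂ)) (𝓝 L) →
      Tendsto u (𝓝[upperHalfPlaneSet] (x : ℂ)) (𝓝 L) := by
    intro x hx L hL
    have h := hL.comp (tendsto_sq_nhdsWithin_of_pos hx)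
    refine h.congr' ?_
    have hre : ∀ᶠ v in 𝓝[upperHalfPlaneSet] (x : ℂ), 0 < v.re :=
      mem_nhdsWithin_of_mem_nhds ((isOpen_lt continuous_const Complex.continuous_re).mem_nhds
        (by simpa using hx))
    filter_upwards [hre] with v hv
    exact (hu_pos v hv).symm
  have hbv_neg : ∀ x : ℝ, x < 0 → ∀ L : ℝ,
      Tendsto H (𝓝[upperHalfPlaneSet] (((x ^ 2 : ℝ)) : ℂ)) (𝓝 L) →
      Tendsto u (𝓝[upperHalfPlaneSet] (x : ℂ)) (𝓝 L) := by
    intro x hx L hL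
    have h := hL.comp (tendsto_conj_sq_nhdsWithin_of_neg hx)
    refine h.congr' ?_
    have hre : ∀ᶠ v in 𝓝[upperHalfPlaneSet] (x : ℂ), v.re < 0 :=
      mem_nhdsWithin_of_mem_nhds ((isOpen_lt Complex.continuous_re continuous_const).mem_nhds
        (by simpa using hx))
    filter_upwards [hre] with v hv
    exact (hu_neg v hv).symm
  have hbv0 : ∀ x : ℝ, x ≠ 0 → |x| < 1 → Tendsto u (𝓝[upperHalfPlaneSet] (x : ℂ)) (𝓝 0) := by
    intro x hx0 hx1
    have hsq : x ^ 2 < 1 := by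
      have := abs_lt.1 hx1; nlinarith
    have hsq0 : 0 < x ^ 2 := by positivity
    rcases lt_or_gt_of_ne hx0 with hn | hp
    · exact hbv_neg x hn 0 (h0 _ hsq0 hsq)
    · exact hbv_pos x hp 0 (h0 _ hsq0 hsq)
  have hbv1 : ∀ x : ℝ, 1 < |x| → Tendsto u (𝓝[upperHalfPlaneSet] (x : ℂ)) (𝓝 1) := by
    intro x hx1
    have hsq : 1 < x ^ 2 := by
      have h2 : 1 < |x| ^ 2 := by nlinarith
      rwa [sq_abs] at h2
    rcases lt_or_gt_of_ne (show x ≠ 0 from fun h ↦ by rw [h, abs_zero] at hx1; linarith) with hn | hp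
    · exact hbv_neg x hn 1 (h1 _ hsq)
    · exact hbv_pos x hp 1 (h1 _ hsq)
  -- identification
  have key := eq_one_sub_hmSeg hu_harm hu_bd ({-1, 0, 1} : Finset ℝ)
    (fun x hx hlt ↦ hbv0 x (fun h ↦ hx (by simp [h])) hlt) (fun x _ hgt ↦ hbv1 x hgt)
  intro w hre him
  rw [← hu_pos w hre]
  exact key w him

end ThreeArc

end Literature.Analysis.Complex
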